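import Summits.ABC.ABC.Theses.IsogenyGlueCongruence
import Summits.ABC.ABC.Theorems.IsogenyGlueCongruenceSharpDegreeOfPolyDegreeOptimalComparison
import Literature.NumberTheory.EllipticCurves.DegreeConjectureAbcMurtyMinimalModelProofs
import Literature.NumberTheory.Automorphic.ShimuraCurveRibetTakahashiOptimalProofs
import Literature.NumberTheory.EllipticCurves.ModularDegreeMinimal
import Summits.ABC.ABC.Theorems.IsogenyGlueCongruenceFrameOverPetersson

-- `Summit.ABC.ABC.…`: summit and sub-problem share the name `ABC` (single-conjunct summit, D-0017).
set_option linter.dupNamespace false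

/-!
# Crux `SharpDegreeOfPolyDegree` (stmt-ABC-10895): the crux is a consequence of the summit

`R := SharpDegreeOfPolyDegree = (Poly → X)`, `X = SemistableDegreeConjecture` (the route's target,
stmt-ABC-2044).  The landed certificates place `R` between the target and its antecedent
(`stub_ofTarget : X → R`; `¬ R ↔ Poly ∧ ¬ X`, `Negative/LogicalPosition.lean`).  This support file
(lands `--supports stmt-ABC-10895`, registered stub `stub_ofAbc`) adds the CEILING: the summit `ABC`
itself implies `X`, hence `R`, modulo inputs of modularity/Manin type only — for SEMISTABLE curves
the analytic input of Murty's direction (ii) (the Petersson upper bound) is a theorem of the tree.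

* `modularDegree_le_maninSq_of_abc` — **unconditional given the summit**: `ABC ⟹ ∀ ε > 0 ∃ C`, every
  datum `D` of every semistable elliptic `W/ℚ` in global minimal form, at any level `N = N_W`, has
  `deg φ_D ≤ C · c_D² · N^{2+ε}` (`c_D` its Manin constant).  Literature theorem
  `modularDegree_le_maninSq_of_abcLe_of_isSemistable(')` (Murty 1999 Thm 1 (ii) run on every minimal
  curve: abc ⟹ generalised Szpiro `abcLe_iff_generalizedSzpiroBG_holds`, Silverman's lower covolume
  inequality, Zagier's identity, and the tree's Petersson bound `(f,f) ≪ N (1 + log N)⁵` at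
  square-free level) composed with `ABC →` the `≤`-form.
* `semistableDegreeConjecture_of_abc_of_facts` — **`ABC ⟹ X` modulo three NAMED inputs of the
  tree**, all known in print: `exists_optimal_modularParametrizationData` (modularity with
  Edixhoven's integral Manin constant: an optimal datum on a GLOBALLY MINIMAL model of the strong
  Weil curve; Wiles 1995, BCDT 2001, Edixhoven 1991 Prop. 2), `abs_maninConstant_eq_one_of_isSemistable`
  (`c = ±1` for the optimal curve of a semistable class; Mazur 1978, Abbes–Ullmo 1996, Česnavičius
  2018) and the route ITEM `MazurKenkuBound` (stmt-ABC-15125 = Pasten's `163`-fact: Mazur 1978 +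
  Kenku 1982).  Chain: `deg_min(W) ≤ 163 · deg D₀` (Mazur–Kenku), `deg D₀ ≤ C · c₀² · N^{2+ε}` (abc,
  first bullet, at the optimal datum `D₀` of the globally minimal semistable `W₀ ~ W`:
  `squarefree_conductorNorm_of_f_eq`, `IsNewformOf.level_eq_conductorNorm_of_squarefree`), `|c₀| = 1`.
* `semistableDegreeConjecture_of_abc_of_boundedManin` — the same from ONE anonymous hypothesis `hM`
  (every semistable `W` in global minimal form carries SOME datum at level `N_W` with `|c_D| ≤ M`;
  in print `M = 163` by the three inputs above with Néron functoriality).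
* `stub_ofAbc` (registered) — `hM → ABC → R`; `sharpDegreeOfPolyDegree_of_abc_of_facts` — the
  named-facts form; `not_abc_of_not_sharpDegreeOfPolyDegree` — a refutation of `R` would refute the
  summit (given the three named inputs).

* `semistableDegreeConjecture_iff_abc_of_facts`, `sharpDegreeOfPolyDegree_iff_poly_imp_abc_of_facts` —
  the circle closed in one statement each: `X ↔ ABC` and `R ↔ (Poly → ABC)` modulo the four named
  inputs (with the route's proved frame `frameOverPetersson_proof`).

With the frame `PeterssonLowerBound → X → ABC` (`FrameOverPetersson`, proved) this closes the circle:
modulo {`PeterssonLowerBound`, `exists_optimal_modularParametrizationData`,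
`abs_maninConstant_eq_one_of_isSemistable`, `MazurKenkuBound`} the target `X` is EQUIVALENT to `ABC`
and the crux `R` is `Poly → ABC`; no proof of `R` short of the summit is to be expected from the
route's mechanism, and no refutation of `R` short of `¬ ABC` exists.

Theorems only; no definitions, no named facts introduced.
-/

noncomputable section

namespace Summit.ABC.ABC.Theorems.SharpDegreeOfPolyDegree

open Summit.ABC.ABC.Theses.IsogenyGlueCongruence
open Literature.NumberTheory.EllipticCurves Literature.NumberTheory.EllipticCurves.ModularForms
open Literature.NumberTheory.DiophantineGeometry Literature.NumberTheory.Automorphic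
open WeierstrassCurve

/-- The summit `ABC` (strict form, `0 < C`) gives the `≤`-form of abc consumed by the Literature
theorems. [folklore] -/
theorem abcLe_of_ABC (h : ABC) :
    ∀ ε : ℝ, 0 < ε → ∃ C : ℝ, ∀ a b c : ℕ, IsABCTriple a b c →
      (c : ℝ) ≤ C * ((rad a b c : ℕ) : ℝ) ^ (1 + ε) := by
  intro ε hε
  obtain ⟨C, -, hC⟩ := (ABC_iff.mp h) ε hε
  exact ⟨C, fun a b c habc => (hC a b c habc).le⟩

/-- **The summit bounds the modular degree of semistable curves up to the Manin constant**
(unconditional given `ABC`): for every `ε > 0` there is `C` with `deg φ_D ≤ C · c_D² · N^{2+ε}`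
for every semistable elliptic `W/ℚ` in global minimal form, every level `N = N_W` and every
parametrisation datum `D` of `W` at level `N`.  Murty 1999 Thm 1 (ii) run on every minimal curve;
the Petersson upper bound at square-free level is a tree theorem. [cite: MurtyCongruencePrimes1999, Thm. 1 (ii) and §2] -/
theorem modularDegree_le_maninSq_of_abc (h : ABC) :
    ∀ ε : ℝ, 0 < ε → ∃ C : ℝ, ∀ (W : WeierstrassCurve ℚ) [W.IsElliptic] [W.IsGloballyMinimal]
      (N : ℕ) [NeZero N], W.conductorNorm ℤ = N → W.IsSemistable ℤ →
        ∀ D : ModularParametrizationData W N,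
          (D.modularDegree : ℝ) ≤ C * (D.maninConstant : ℝ) ^ 2 * (N : ℝ) ^ (2 + ε) := by
  -- (= `modularDegree_le_maninSq_of_abcLe_of_isSemistable' (abcLe_of_ABC h)`; derived here from the
  -- fixed-level form so as not to depend on the farm snapshot of the Literature module)
  intro ε hε
  obtain ⟨C, hC⟩ := modularDegree_le_maninSq_of_abcLe_of_isSemistable (abcLe_of_ABC h) ε hε
  refine ⟨C, fun W _ _ N _ hN hss D ↦ ?_⟩
  subst hN
  exact hC W hss D

/-- **`ABC ⟹ X` modulo three named inputs of the tree** (modularity with an integral Manin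
constant `exists_optimal_modularParametrizationData`; `|c| = 1` for the semistable optimal curve
`abs_maninConstant_eq_one_of_isSemistable`; the route item `MazurKenkuBound`, stmt-ABC-15125).  For a
semistable `W` in global minimal form of conductor `N`: the optimal datum `D₀` lives on a globally
minimal `W₀` with the newform of `W` (modularity + Edixhoven), `W₀` is semistable of conductor `N`
(`squarefree_conductorNorm_of_f_eq`, Carayol's semistable case
`IsNewformOf.level_eq_conductorNorm_of_squarefree`), `|c₀| = 1`, so `deg D₀ ≤ C N^{2+ε}` by
`modularDegree_le_maninSq_of_abc`; and a minimal datum `D₁` of `W` has `deg D₁ ≤ 163 · deg D₀`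
(Mazur–Kenku). [cite: MurtyCongruencePrimes1999, Thm. 1 (ii)] [cite: PastenShimura2024, §3 p. 13 and Rem. 3.3] -/
theorem semistableDegreeConjecture_of_abc_of_facts
    (hOpt : exists_optimal_modularParametrizationData)
    (hc1 : ∀ {N : ℕ} [NeZero N] {W₀ : WeierstrassCurve ℚ} (D₀ : ModularParametrizationData W₀ N),
      D₀.abs_maninConstant_eq_one_of_isSemistable)
    (hMK : MazurKenkuBound) (h : ABC) : SemistableDegreeConjecture := by
  intro ε hε
  obtain ⟨C, hC⟩ := modularDegree_le_maninSq_of_abc h ε hε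
  refine ⟨163 * max C 0, fun W _ _ _ hss => ?_⟩
  have hsq : Squarefree (W.conductorNorm ℤ) := (W.isSemistable_iff_squarefree_conductorNorm).mp hss
  -- the optimal datum on a globally minimal model, with the newform of `W`
  obtain ⟨W₀, hW₀, hW₀min, D₀, hfW, -, hmin₀⟩ := hOpt (W.conductorNorm ℤ) W rfl
  haveI := hW₀
  haveI := hW₀min
  -- a datum of `W` of minimal degree (modularity is implied by `hOpt`)
  have hmod := nonempty_modularParametrizationData_of_exists_optimal hOpt
  obtain ⟨D₁, -, hmin₁⟩ := exists_minimal_datum (W := W) (N := W.conductorNorm ℤ) (hmod W)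
  refine ⟨D₁, ?_⟩
  -- same newform
  have hf : D₁.f = D₀.f := D₁.isNewformOf.unique hfW
  -- `W₀` is semistable with conductor `N_W`
  have hsq₀ : Squarefree (W₀.conductorNorm ℤ) := squarefree_conductorNorm_of_f_eq D₀ D₁ hf.symm hsq
  have hN₀ : W.conductorNorm ℤ = W₀.conductorNorm ℤ :=
    D₀.isNewformOf.level_eq_conductorNorm_of_squarefree hsq₀
  have hss₀ : W₀.IsSemistable ℤ := (W₀.isSemistable_iff_squarefree_conductorNorm).mpr hsq₀
  -- the Manin constant of the optimal datum is `±1`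
  have hc : |D₀.maninConstant| = 1 := hc1 D₀ hss₀ hmin₀
  have hc2 : (D₀.maninConstant : ℝ) ^ 2 = 1 := by
    have h1 : ((|D₀.maninConstant| : ℤ) : ℝ) = 1 := by exact_mod_cast hc
    rw [Int.cast_abs] at h1
    rw [← sq_abs, h1, one_pow]
  -- Mazur–Kenku: `deg D₁ ≤ 163 · deg D₀`
  have h163 : D₁.modularDegree ≤ 163 * D₀.modularDegree :=
    hMK (W.conductorNorm ℤ) W₀ W D₀ D₁ hf hmin₀ hmin₁
  -- abc at the optimal datum: `deg D₀ ≤ C · 1 · N^{2+ε}`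
  have hdeg₀ := hC W₀ (W.conductorNorm ℤ) hN₀.symm hss₀ D₀
  rw [hc2, mul_one] at hdeg₀
  have hN0 : (0 : ℝ) ≤ (W.conductorNorm ℤ : ℝ) ^ (2 + ε) := by positivity
  calc (D₁.modularDegree : ℝ) ≤ ((163 * D₀.modularDegree : ℕ) : ℝ) := by exact_mod_cast h163
    _ = 163 * (D₀.modularDegree : ℝ) := by push_cast; ring
    _ ≤ 163 * (C * (W.conductorNorm ℤ : ℝ) ^ (2 + ε)) :=
        mul_le_mul_of_nonneg_left hdeg₀ (by norm_num)
    _ ≤ 163 * (max C 0 * (W.conductorNorm ℤ : ℝ) ^ (2 + ε)) := by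
        gcongr; exact le_max_left _ _
    _ = 163 * max C 0 * (W.conductorNorm ℤ : ℝ) ^ (2 + ε) := by ring

/-- **`ABC ⟹ R` modulo the same three named inputs.** [cite: MurtyCongruencePrimes1999, Thm. 1] -/
theorem sharpDegreeOfPolyDegree_of_abc_of_facts
    (hOpt : exists_optimal_modularParametrizationData)
    (hc1 : ∀ {N : ℕ} [NeZero N] {W₀ : WeierstrassCurve ℚ} (D₀ : ModularParametrizationData W₀ N),
      D₀.abs_maninConstant_eq_one_of_isSemistable)
    (hMK : MazurKenkuBound) (h : ABC) : SharpDegreeOfPolyDegree :=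
  fun _ => semistableDegreeConjecture_of_abc_of_facts hOpt hc1 hMK h

/-- **Why the crux resists refutation**: given the three named inputs, a proof of
`¬ SharpDegreeOfPolyDegree` would be a disproof of the abc conjecture. [folklore] -/
theorem not_abc_of_not_sharpDegreeOfPolyDegree
    (hOpt : exists_optimal_modularParametrizationData)
    (hc1 : ∀ {N : ℕ} [NeZero N] {W₀ : WeierstrassCurve ℚ} (D₀ : ModularParametrizationData W₀ N),
      D₀.abs_maninConstant_eq_one_of_isSemistable)
    (hMK : MazurKenkuBound) (hR : ¬ SharpDegreeOfPolyDegree) : ¬ ABC :=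
  fun h => hR (sharpDegreeOfPolyDegree_of_abc_of_facts hOpt hc1 hMK h)

/-- **`ABC ⟹ X` modulo a bounded Manin constant** (one anonymous hypothesis): if every semistable
elliptic `W/ℚ` in global minimal form has some parametrisation datum at level `N_W` whose Manin
constant is bounded by an absolute `M` (`hM`; in print `M = 163`: modularity, Manin `±1` for the
optimal curve, Mazur–Kenku and Néron functoriality), then the summit implies the route's target.
[cite: MurtyCongruencePrimes1999, Thm. 1 (ii)] [cite: PastenShimura2024, Rem. 3.3] -/
theorem semistableDegreeConjecture_of_abc_of_boundedManin
    (hM : ∃ M : ℕ, ∀ (W : WeierstrassCurve ℚ) [W.IsElliptic] [W.IsGloballyMinimal]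
      [NeZero (W.conductorNorm ℤ)], W.IsSemistable ℤ →
        ∃ D : ModularParametrizationData W (W.conductorNorm ℤ), D.maninConstant.natAbs ≤ M)
    (h : ABC) : SemistableDegreeConjecture := by
  intro ε hε
  obtain ⟨M, hMW⟩ := hM
  obtain ⟨C, hC⟩ := modularDegree_le_maninSq_of_abc h ε hε
  refine ⟨max C 0 * (M : ℝ) ^ 2, fun W _ _ _ hss => ?_⟩
  obtain ⟨D, hD⟩ := hMW W hss
  refine ⟨D, ?_⟩
  have hdeg := hC W (W.conductorNorm ℤ) rfl hss D
  have hN0 : (0 : ℝ) ≤ (W.conductorNorm ℤ : ℝ) ^ (2 + ε) := by positivity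
  have habs : |(D.maninConstant : ℝ)| ≤ M := by
    have h1 : ((D.maninConstant.natAbs : ℕ) : ℝ) ≤ (M : ℝ) := by exact_mod_cast hD
    rwa [Nat.cast_natAbs, Int.cast_abs] at h1
  have hc2 : (D.maninConstant : ℝ) ^ 2 ≤ (M : ℝ) ^ 2 := by
    rw [← sq_abs]
    exact pow_le_pow_left₀ (abs_nonneg _) habs 2
  calc (D.modularDegree : ℝ)
      ≤ C * (D.maninConstant : ℝ) ^ 2 * (W.conductorNorm ℤ : ℝ) ^ (2 + ε) := hdeg
    _ ≤ max C 0 * (D.maninConstant : ℝ) ^ 2 * (W.conductorNorm ℤ : ℝ) ^ (2 + ε) := by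
        gcongr; exact le_max_left _ _
    _ ≤ max C 0 * (M : ℝ) ^ 2 * (W.conductorNorm ℤ : ℝ) ^ (2 + ε) := by
        gcongr

/-- **Registered stub `stub_ofAbc`: the crux is a consequence of the summit** (modulo the bounded
Manin constant `hM`): `ABC ⟹ X ⟹ R`.  Together with `stub_ofTarget : X → R`, the landed
`¬ R ↔ Poly ∧ ¬ X` and the proved frame `PeterssonLowerBound → X → ABC`, this pins `R` as
`Poly → ABC` modulo {`PeterssonLowerBound`, `hM`} (or the three named inputs of
`sharpDegreeOfPolyDegree_of_abc_of_facts`): abc-strength exactly, as the route declares.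
[cite: MurtyCongruencePrimes1999, Thm. 1] -/
theorem stub_ofAbc :
    (∃ M : ℕ, ∀ (W : WeierstrassCurve ℚ) [W.IsElliptic] [W.IsGloballyMinimal]
      [NeZero (W.conductorNorm ℤ)], W.IsSemistable ℤ →
        ∃ D : ModularParametrizationData W (W.conductorNorm ℤ), D.maninConstant.natAbs ≤ M) →
    ABC → SharpDegreeOfPolyDegree :=
  fun hM h _ => semistableDegreeConjecture_of_abc_of_boundedManin hM h

/-! ## The circle closed: `X ⟺ ABC` and `R ⟺ (Poly → ABC)` modulo the named inputs -/

/-- **The target is equivalent to the summit** modulo {`PeterssonLowerBound` (route item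
stmt-ABC-10870), `exists_optimal_modularParametrizationData`, `abs_maninConstant_eq_one_of_isSemistable`,
`MazurKenkuBound` (stmt-ABC-15125)}: `⇒` is the route's proved frame
`Summit.ABC.ABC.Theorems.frameOverPetersson_proof` (Zagier + Silverman + Petersson lower bound),
`⇐` is `semistableDegreeConjecture_of_abc_of_facts`.  Murty 1999 Thm 1 beyond Frey curves, for the
semistable class. [cite: MurtyCongruencePrimes1999, Thm. 1] -/
theorem semistableDegreeConjecture_iff_abc_of_facts (hP : PeterssonLowerBound)
    (hOpt : exists_optimal_modularParametrizationData)
    (hc1 : ∀ {N : ℕ} [NeZero N] {W₀ : WeierstrassCurve ℚ} (D₀ : ModularParametrizationData W₀ N),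
      D₀.abs_maninConstant_eq_one_of_isSemistable)
    (hMK : MazurKenkuBound) : SemistableDegreeConjecture ↔ ABC :=
  ⟨fun hX => Summit.ABC.ABC.Theorems.frameOverPetersson_proof hP hX,
    semistableDegreeConjecture_of_abc_of_facts hOpt hc1 hMK⟩

/-- **The crux is `Poly → ABC`** modulo the same four named inputs: `R = (Poly → X)` and
`X ⟺ ABC`.  This is the kernel-checked form of the route's own description of `R` as "the declared
abc-strength residual": granted the antecedent, proving `R` is proving the summit, and refuting `R`
is refuting it. [cite: MurtyCongruencePrimes1999, Thm. 1] -/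
theorem sharpDegreeOfPolyDegree_iff_poly_imp_abc_of_facts (hP : PeterssonLowerBound)
    (hOpt : exists_optimal_modularParametrizationData)
    (hc1 : ∀ {N : ℕ} [NeZero N] {W₀ : WeierstrassCurve ℚ} (D₀ : ModularParametrizationData W₀ N),
      D₀.abs_maninConstant_eq_one_of_isSemistable)
    (hMK : MazurKenkuBound) :
    SharpDegreeOfPolyDegree ↔
      ((∃ κ C : ℝ, ∀ (W : WeierstrassCurve ℚ) [W.IsElliptic] [W.IsGloballyMinimal]
        [NeZero (W.conductorNorm ℤ)], W.IsSemistable ℤ →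
          ∃ D : ModularParametrizationData W (W.conductorNorm ℤ),
            (D.modularDegree : ℝ) ≤ C * (W.conductorNorm ℤ : ℝ) ^ κ) → ABC) :=
  ⟨fun hR hPoly => Summit.ABC.ABC.Theorems.frameOverPetersson_proof hP (hR hPoly),
    fun h hPoly => semistableDegreeConjecture_of_abc_of_facts hOpt hc1 hMK (h hPoly)⟩

end Summit.ABC.ABC.Theorems.SharpDegreeOfPolyDegree

end
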